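import Summits.ABC.IUTFork.LDHSplitBadWitnessPoint
import Literature.IUT.LogVolume.Corollary22TwoAdicIntegrality
import HarnessLib

/-!
# The fork at [IUTchIII] Corollary 3.12, L-DH level: ADMISSIBLE points ON the split-bad locus — II. The poles of
# `j(λ_m)`: every ODD pole divides `1 + i·2^{m+1}` or `1 + i·2^m`, and complex conjugates of poles are not poles

Proof-only file (D-0012; 0 definitions, no `Prop` fact) of the abc-iut cell (seat abc-iut-w5-d126), sequel of
`LDHSplitBadWitnessPoint.lean`. TAKES NO SIDE on [IUTchIII] Cor. 3.12 or [IUTchIV] Thm. 1.10; classical arithmetic of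
`ℤ[i]`. S. Mochizuki, *IUT IV* [Mochizuki2012], Cor. 2.2 (ii) proof (P5) p. 46 (bad places = poles of `j(λ)`); K. Ireland,
M. Rosen [IrelandRosen1982], Ch. 9 §7 p. 120; J. Neukirch [NeukirchANT1999], Ch. I §11 (valuations of a Dedekind ring).

For `ζ = i ∈ 𝓞 F` (a primitive fourth root of unity), `m : ℕ`, `λ_m = i2^m/(1 + i2^{m+1})`, the point
`P_m = (F, λ_m)` and a finite place `V` of `F`:
* `(1 + i2^{m+1})(1 − i2^{m+1}) = 1 + 4^{m+1}`, `(1 + i2^m)(1 − i2^m) = 1 + 4^m`, `4^n = 3t + 1`;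
* **cross lemma** `two_mem_of_mem_of_mem`: if `V ∋` one of `1 + i2^{m+1}, 1 + i2^m` AND one of their conjugates
  `1 − i2^{m+1}, 1 − i2^m`, then `2 ∈ V` (the four cases give `2`, or `3` together with `1 + 4^k ≡ 2 (mod 3)`);
* **Case A** (`notMem_badPlaces`): at an ODD place dividing neither `1 + i2^{m+1}` nor `1 + i2^m`, `λ_m` and `1 − λ_m`
  are units, so `|j(λ_m)|_V ≤ 1` (ultrametric inequality on `λ² − λ + 1`) — `V` is not a bad place; hence
  **odd bad places divide `1 + i2^{m+1}` or `1 + i2^m`** (`mem_or_mem_of_mem_badPlaces`);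
* **Case B** (`ord_jInv_of_mem`): if `1 + i2^{m+1} ∈ V` then `|λ_m|_V = |1 + i2^{m+1}|_V^{−1} > 1`, the strict
  ultrametric equality gives `|λ² − λ + 1| = |λ|²`, and `ord_V j(λ_m) = −2·ord_V(1 + i2^{m+1}) < 0`: `V` IS bad, with
  local height `2·ord_V(1 + i2^{m+1})`.
HONEST SCOPE: classical; nothing asserted about print. [cite: IrelandRosen1982, Ch. 9 §7 p. 120]
[cite: NeukirchANT1999, Ch. I §11] [claim: Mochizuki2012, status: disputed] for every IUT locator quoted.
-/

noncomputable section

namespace Summit.ABC.IUTFork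

namespace SplitBadWitness

open NumberField IsDedekindDomain Finset
open Literature.IUT.LogVolume Literature.IUT.LogVolume.Cor22
open Literature.NumberTheory.DiophantineGeometry Literature.NumberTheory.DiophantineGeometry.GenEll

variable {F : Type} [Field F] [NumberField F] {ζ : 𝓞 F}

/-! ## Norm identities in `ℤ[i]` -/

omit [NumberField F] in
/-- `(1 + i·2^k)(1 − i·2^k) = 1 + 4^k` in `𝓞 F`. [cite: IrelandRosen1982, Ch. 9 §7 p. 120] -/
theorem one_add_mul_one_sub (hζ : IsPrimitiveRoot ζ 4) (k : ℕ) :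
    (1 + ζ * 2 ^ k) * (1 - ζ * 2 ^ k) = ((1 + 4 ^ k : ℕ) : 𝓞 F) := by
  have hsq : ζ ^ 2 = -1 := (hζ.pow (by norm_num) (by norm_num : 4 = 2 * 2)).eq_neg_one_of_two_right
  have h4 : (4 : 𝓞 F) ^ k = (2 ^ k) ^ 2 := by rw [← pow_mul, mul_comm, pow_mul]; norm_num
  push_cast
  rw [h4]
  linear_combination (-((2 : 𝓞 F) ^ k) ^ 2) * hsq

omit [Field F] [NumberField F] in
/-- `4^n = 3t + 1`. [cite: IrelandRosen1982, Ch. 9 §7 p. 120] -/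
theorem four_pow_eq (n : ℕ) : ∃ t : ℕ, 4 ^ n = 3 * t + 1 := by
  induction n with
  | zero => exact ⟨0, by norm_num⟩
  | succ n ih =>
    obtain ⟨t, ht⟩ := ih
    exact ⟨4 * t + 1, by rw [pow_succ, ht]; ring⟩

/-! ## The cross lemma: no place contains a member of `{β, γ}` and a member of `{β̄, γ̄}` unless it contains `2` -/

omit [NumberField F] in
/-- One of `1 + i2^a ∈ V` together with the conjugate `1 − i2^b ∈ V`, for `{a, b} ⊆ {m, m+1}`, forces `2 ∈ V`: for `a = b`
the sum is `2`; for `a ≠ b` one gets `3 ∈ V` and `1 + 4^{a} ∈ V` with `1 + 4^a ≡ 2 (mod 3)`.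
[cite: IrelandRosen1982, Ch. 9 §7 p. 120] -/
theorem two_mem_of_mem_of_mem (hζ : IsPrimitiveRoot ζ 4) (m : ℕ) (I : Ideal (𝓞 F))
    (h1 : 1 + ζ * 2 ^ (m + 1) ∈ I ∨ 1 + ζ * 2 ^ m ∈ I) (h2 : 1 - ζ * 2 ^ (m + 1) ∈ I ∨ 1 - ζ * 2 ^ m ∈ I) :
    (2 : 𝓞 F) ∈ I := by
  rcases h1 with hb | hg <;> rcases h2 with hb' | hg'
  · have : (2 : 𝓞 F) = (1 + ζ * 2 ^ (m + 1)) + (1 - ζ * 2 ^ (m + 1)) := by ring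
    rw [this]; exact I.add_mem hb hb'
  · have h3 : (3 : 𝓞 F) ∈ I := by
      have : (3 : 𝓞 F) = (1 + ζ * 2 ^ (m + 1)) + 2 * (1 - ζ * 2 ^ m) := by ring
      rw [this]; exact I.add_mem hb (I.mul_mem_left _ hg')
    have hN : ((1 + 4 ^ (m + 1) : ℕ) : 𝓞 F) ∈ I := by
      rw [← one_add_mul_one_sub hζ]; exact I.mul_mem_right _ hb
    obtain ⟨t, ht⟩ := four_pow_eq (m + 1)
    have : (2 : 𝓞 F) = ((1 + 4 ^ (m + 1) : ℕ) : 𝓞 F) - 3 * t := by rw [ht]; push_cast; ring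
    rw [this]; exact I.sub_mem hN (I.mul_mem_right _ h3)
  · have h3 : (3 : 𝓞 F) ∈ I := by
      have : (3 : 𝓞 F) = 2 * (1 + ζ * 2 ^ m) + (1 - ζ * 2 ^ (m + 1)) := by ring
      rw [this]; exact I.add_mem (I.mul_mem_left _ hg) hb'
    have hN : ((1 + 4 ^ m : ℕ) : 𝓞 F) ∈ I := by
      rw [← one_add_mul_one_sub hζ]; exact I.mul_mem_right _ hg
    obtain ⟨t, ht⟩ := four_pow_eq m
    have : (2 : 𝓞 F) = ((1 + 4 ^ m : ℕ) : 𝓞 F) - 3 * t := by rw [ht]; push_cast; ring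
    rw [this]; exact I.sub_mem hN (I.mul_mem_right _ h3)
  · have : (2 : 𝓞 F) = (1 + ζ * 2 ^ m) + (1 - ζ * 2 ^ m) := by ring
    rw [this]; exact I.add_mem hg hg'

omit [NumberField F] in
/-- `1 + i2^{m+1} ∈ V ⟹ 2 ∉ V` for a proper ideal (`(1 + i2^{m+1}) − 2·(i2^m) = 1`). [cite: IrelandRosen1982, Ch. 9 §7 p. 120] -/
theorem two_notMem_of_mem {m : ℕ} {I : Ideal (𝓞 F)} (hI : I ≠ ⊤) (h : 1 + ζ * 2 ^ (m + 1) ∈ I) : (2 : 𝓞 F) ∉ I := by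
  intro h2
  apply hI
  rw [Ideal.eq_top_iff_one]
  have : (1 : 𝓞 F) = (1 + ζ * 2 ^ (m + 1)) - 2 * (ζ * 2 ^ m) := by ring
  rw [this]; exact I.sub_mem h (I.mul_mem_right _ h2)

omit [NumberField F] in
/-- `1 + i2^{m+1} ∈ V ⟹ 1 + i2^m ∉ V` for a proper ideal (`2(1 + i2^m) − (1 + i2^{m+1}) = 1`). [cite: IrelandRosen1982, Ch. 9 §7 p. 120] -/
theorem notMem_of_mem {m : ℕ} {I : Ideal (𝓞 F)} (hI : I ≠ ⊤) (h : 1 + ζ * 2 ^ (m + 1) ∈ I) : 1 + ζ * 2 ^ m ∉ I := by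
  intro hg
  apply hI
  rw [Ideal.eq_top_iff_one]
  have : (1 : 𝓞 F) = 2 * (1 + ζ * 2 ^ m) - (1 + ζ * 2 ^ (m + 1)) := by ring
  rw [this]; exact I.sub_mem (I.mul_mem_left _ hg) h

/-! ## Valuations at a finite place -/

omit [NumberField F] in
/-- Field images of the integral elements `1 ± i·2^k`. [cite: IrelandRosen1982, Ch. 9 §7 p. 120] -/
theorem coe_one_add (ζ : 𝓞 F) (k : ℕ) : (((1 + ζ * 2 ^ k : 𝓞 F)) : F) = 1 + (ζ : F) * 2 ^ k := by
  simp only [RingOfIntegers.coe_eq_algebraMap, map_add, map_one, map_mul, map_pow, map_ofNat]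

/-- `1 + i·2^k ≠ 0` in `𝓞 F`. [cite: IrelandRosen1982, Ch. 9 §7 p. 120] -/
theorem one_add_ne_zero (hζ : IsPrimitiveRoot ζ 4) (k : ℕ) : (1 + ζ * 2 ^ k : 𝓞 F) ≠ 0 := fun h =>
  one_add_mul_pow_ne_zero hζ k (by rw [← coe_one_add, h, RingOfIntegers.coe_eq_algebraMap, map_zero])

/-- An algebraic integer outside `V` is a `V`-unit. [cite: NeukirchANT1999, Ch. I §11] -/
theorem val_eq_one_of_notMem (V : HeightOneSpectrum (𝓞 F)) (x : 𝓞 F) (hx : x ∉ V.asIdeal) :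
    V.valuation F (x : F) = 1 :=
  le_antisymm (V.valuation_le_one (K := F) x) (not_lt.1 (mt (V.valuation_lt_one_iff_mem (K := F) x).1 hx))

/-- At an odd place `2` is a unit. [cite: NeukirchANT1999, Ch. I §11] -/
theorem val_two (V : HeightOneSpectrum (𝓞 F)) (hV : (2 : 𝓞 F) ∉ V.asIdeal) : V.valuation F (2 : F) = 1 := by
  rw [show (2 : F) = ((2 : 𝓞 F) : F) from (map_ofNat (algebraMap (𝓞 F) F) 2).symm]
  exact val_eq_one_of_notMem V 2 hV

/-- `i` is a unit at every finite place. [cite: IrelandRosen1982, Ch. 9 §7 p. 120] -/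
theorem val_coe (hζ : IsPrimitiveRoot ζ 4) (V : HeightOneSpectrum (𝓞 F)) : V.valuation F (ζ : F) = 1 := by
  refine val_eq_one_of_notMem V ζ fun h => V.isPrime.ne_top ?_
  rw [Ideal.eq_top_iff_one, ← hζ.pow_eq_one]
  exact V.asIdeal.pow_mem_of_mem h 4 (by norm_num)

/-- `|λ_m|_V · |1 + i2^{m+1}|_V = 1` at an odd place (`λ_m·(1 + i2^{m+1}) = i2^m` is a unit there). [cite: NeukirchANT1999, Ch. I §11] -/
theorem val_lam_mul (hζ : IsPrimitiveRoot ζ 4) (m : ℕ) (V : HeightOneSpectrum (𝓞 F)) (hV : (2 : 𝓞 F) ∉ V.asIdeal) :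
    V.valuation F ((ζ : F) * 2 ^ m / (1 + (ζ : F) * 2 ^ (m + 1))) * V.valuation F (1 + (ζ : F) * 2 ^ (m + 1)) = 1 := by
  rw [← map_mul, div_mul_cancel₀ _ (one_add_mul_pow_ne_zero hζ (m + 1)), map_mul, map_pow, val_coe hζ, val_two V hV]
  simp

/-- `|1 − λ_m|_V · |1 + i2^{m+1}|_V = |1 + i2^m|_V`. [cite: NeukirchANT1999, Ch. I §11] -/
theorem val_one_sub_lam_mul (hζ : IsPrimitiveRoot ζ 4) (m : ℕ) (V : HeightOneSpectrum (𝓞 F)) :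
    V.valuation F (1 - (ζ : F) * 2 ^ m / (1 + (ζ : F) * 2 ^ (m + 1))) * V.valuation F (1 + (ζ : F) * 2 ^ (m + 1)) =
      V.valuation F (1 + (ζ : F) * 2 ^ m) := by
  rw [← map_mul, one_sub_lam hζ, div_mul_cancel₀ _ (one_add_mul_pow_ne_zero hζ (m + 1))]

/-! ## Case A: odd places away from `1 + i2^{m+1}` and `1 + i2^m` are not bad -/

/-- **Case A (no pole).** At an odd place `V` containing neither `1 + i2^{m+1}` nor `1 + i2^m`, `j(λ_m)` is `V`-integral:
`V` is not a bad place of `P_m`. [cite: Mochizuki2012, IUTchIV Cor 2.2 (ii) proof (P5) p.46] [claim: Mochizuki2012, status: disputed] -/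
theorem notMem_badPlaces (hζ : IsPrimitiveRoot ζ 4) (m : ℕ) (V : HeightOneSpectrum (𝓞 F)) (hV : (2 : 𝓞 F) ∉ V.asIdeal)
    (hβ : 1 + ζ * 2 ^ (m + 1) ∉ V.asIdeal) (hγ : 1 + ζ * 2 ^ m ∉ V.asIdeal) :
    V ∉ badPlaces (⟨F, (ζ : F) * 2 ^ m / (1 + (ζ : F) * 2 ^ (m + 1))⟩ : NFPoint) := by
  intro hbad
  have hneg := (mem_badPlaces_iff_ord_neg (⟨F, (ζ : F) * 2 ^ m / (1 + (ζ : F) * 2 ^ (m + 1))⟩ : NFPoint) V).1 hbad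
  revert hneg
  rw [imp_false, not_lt]
  change 0 ≤ ord F V (jInv ((ζ : F) * 2 ^ m / (1 + (ζ : F) * 2 ^ (m + 1))))
  set x := (ζ : F) * 2 ^ m / (1 + (ζ : F) * 2 ^ (m + 1)) with hx
  have hvβ : V.valuation F (1 + (ζ : F) * 2 ^ (m + 1)) = 1 := by
    rw [← coe_one_add]; exact val_eq_one_of_notMem V _ hβ
  have hvγ : V.valuation F (1 + (ζ : F) * 2 ^ m) = 1 := by
    rw [← coe_one_add]; exact val_eq_one_of_notMem V _ hγ
  have hvl : V.valuation F x = 1 := by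
    have := val_lam_mul hζ m V hV; rwa [hvβ, mul_one] at this
  have hv1 : V.valuation F (1 - x) = 1 := by
    have := val_one_sub_lam_mul hζ m V; rwa [hvβ, mul_one, hvγ] at this
  have hvl1 : V.valuation F (x - 1) = 1 := by rw [← neg_sub, Valuation.map_neg, hv1]
  have hnum : V.valuation F (x ^ 2 - x + 1) ≤ 1 := by
    refine Valuation.map_add_le _ (Valuation.map_sub_le _ ?_ ?_) (by rw [map_one])
    · rw [map_pow, hvl, one_pow]
    · rw [hvl]
  by_cases hj : jInv x = 0
  · rw [hj, ord_zero]
  refine ord_nonneg_of_valuation_le_one V hj ?_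
  unfold jInv
  rw [map_div₀, map_mul, map_mul, map_pow, map_pow, map_pow, map_pow, val_two V hV, hvl, hvl1]
  simpa using pow_le_one₀ zero_le hnum

/-- **Odd bad places divide `1 + i2^{m+1}` or `1 + i2^m`.** [cite: Mochizuki2012, IUTchIV Cor 2.2 (ii) proof (P5) p.46] [claim: Mochizuki2012, status: disputed] -/
theorem mem_or_mem_of_mem_badPlaces (hζ : IsPrimitiveRoot ζ 4) (m : ℕ) (V : HeightOneSpectrum (𝓞 F))
    (hV : (2 : 𝓞 F) ∉ V.asIdeal) (hbad : V ∈ badPlaces (⟨F, (ζ : F) * 2 ^ m / (1 + (ζ : F) * 2 ^ (m + 1))⟩ : NFPoint)) :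
    1 + ζ * 2 ^ (m + 1) ∈ V.asIdeal ∨ 1 + ζ * 2 ^ m ∈ V.asIdeal := by
  by_contra h
  push Not at h
  exact notMem_badPlaces hζ m V hV h.1 h.2 hbad

/-! ## Case B: places above `1 + i2^{m+1}` are bad, with local height `2·ord_V(1 + i2^{m+1})` -/

/-- **Case B (a pole).** If `1 + i2^{m+1} ∈ V` then `ord_V j(λ_m) = −2·ord_V(1 + i2^{m+1})` and `ord_V(1 + i2^{m+1}) > 0`.
[cite: Mochizuki2012, IUTchIV Cor 2.2 (ii) proof (P5) p.46] [claim: Mochizuki2012, status: disputed] [cite: NeukirchANT1999, Ch. I §11] -/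
theorem ord_jInv_of_mem (hζ : IsPrimitiveRoot ζ 4) (m : ℕ) (V : HeightOneSpectrum (𝓞 F)) (hβ : 1 + ζ * 2 ^ (m + 1) ∈ V.asIdeal) :
    ord F V (jInv ((ζ : F) * 2 ^ m / (1 + (ζ : F) * 2 ^ (m + 1)))) = -2 * ord F V (1 + (ζ : F) * 2 ^ (m + 1)) ∧
      0 < ord F V (1 + (ζ : F) * 2 ^ (m + 1)) := by
  have hV : (2 : 𝓞 F) ∉ V.asIdeal := two_notMem_of_mem V.isPrime.ne_top hβ
  have hγ : 1 + ζ * 2 ^ m ∉ V.asIdeal := notMem_of_mem V.isPrime.ne_top hβ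
  set x := (ζ : F) * 2 ^ m / (1 + (ζ : F) * 2 ^ (m + 1)) with hx
  set b := 1 + (ζ : F) * 2 ^ (m + 1) with hb
  have hb0 : b ≠ 0 := one_add_mul_pow_ne_zero hζ (m + 1)
  have hvβ : V.valuation F b < 1 := by
    rw [hb, ← coe_one_add]; exact (V.valuation_lt_one_iff_mem (K := F) _).2 hβ
  have hvβ0 : V.valuation F b ≠ 0 := (V.valuation F).ne_zero_iff.mpr hb0
  have hvγ : V.valuation F (1 + (ζ : F) * 2 ^ m) = 1 := by
    rw [← coe_one_add]; exact val_eq_one_of_notMem V _ hγ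
  have hvl : V.valuation F x = (V.valuation F b)⁻¹ := eq_inv_of_mul_eq_one_left (val_lam_mul hζ m V hV)
  have hv1 : V.valuation F (1 - x) = (V.valuation F b)⁻¹ := by
    apply eq_inv_of_mul_eq_one_left
    rw [hx, hb, val_one_sub_lam_mul hζ m V, hvγ]
  have hvl1 : V.valuation F (x - 1) = V.valuation F x := by rw [← neg_sub, Valuation.map_neg, hv1, hvl]
  have hgt : 1 < V.valuation F x := by rw [hvl]; exact one_lt_inv₀ (zero_lt_iff.mpr hvβ0) |>.mpr hvβ
  -- strict ultrametric equality: `|x² − x + 1| = |x²|`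
  have hnum : V.valuation F (x ^ 2 - x + 1) = V.valuation F (x ^ 2) := by
    have e1 : x ^ 2 - x + 1 = x ^ 2 + (-x + 1) := by ring
    rw [e1]
    refine Valuation.map_add_eq_of_lt_left _ ?_
    have hlt : V.valuation F x < V.valuation F (x ^ 2) := by
      rw [map_pow, sq]
      exact lt_mul_of_one_lt_left (zero_lt_one.trans hgt) hgt
    refine lt_of_le_of_lt (Valuation.map_add_le _ ?_ ?_) hlt
    · rw [Valuation.map_neg]
    · rw [map_one]; exact hgt.le
  have hl0 : x ≠ 0 := lam_ne_zero hζ m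
  have hl1 : x - 1 ≠ 0 := sub_ne_zero.mpr (lam_ne_one hζ m)
  have hnum0 : x ^ 2 - x + 1 ≠ 0 := by
    intro h0
    have : V.valuation F (x ^ 2) = 0 := by rw [← hnum, h0, map_zero]
    exact pow_ne_zero 2 hl0 (((V.valuation F).zero_iff).mp this)
  -- read everything off in `ord`
  have hordnum : ord F V (x ^ 2 - x + 1) = 2 * ord F V x := by
    have h := ord_pow F V x 2
    have h' : ord F V (x ^ 2 - x + 1) = ord F V (x ^ 2) := by unfold ord; rw [hnum]
    rw [h', h]; norm_num
  have hord1 : ord F V (x - 1) = ord F V x := by unfold ord; rw [hvl1]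
  have hord2 : ord F V (2 : F) = 0 := by unfold ord; rw [val_two V hV, WithZero.log_one, neg_zero]
  have hordβ : ord F V x = -ord F V b := by unfold ord; rw [hvl, WithZero.log_inv]
  have hj : jInv x = (2 ^ 8 * (x ^ 2 - x + 1) ^ 3) * (x ^ 2 * (x - 1) ^ 2)⁻¹ := by
    unfold jInv; rw [div_eq_mul_inv]
  refine ⟨?_, ?_⟩
  · rw [hj, ord_mul F V (mul_ne_zero (pow_ne_zero _ two_ne_zero) (pow_ne_zero _ hnum0))
        (inv_ne_zero (mul_ne_zero (pow_ne_zero _ hl0) (pow_ne_zero _ hl1))),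
      ord_mul F V (pow_ne_zero _ two_ne_zero) (pow_ne_zero _ hnum0), ord_inv,
      ord_mul F V (pow_ne_zero _ hl0) (pow_ne_zero _ hl1), ord_pow, ord_pow, ord_pow, ord_pow, hord2, hordnum,
      hord1, hordβ]
    push_cast
    ring
  · have h := (ord_pos_iff_mem F V (1 + ζ * 2 ^ (m + 1)) (one_add_ne_zero hζ (m + 1))).mpr hβ
    rwa [coe_one_add] at h

/-- **A place above `1 + i2^{m+1}` is a bad place of `P_m`.** [cite: Mochizuki2012, IUTchIV Cor 2.2 (ii) proof (P5) p.46] [claim: Mochizuki2012, status: disputed] -/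
theorem mem_badPlaces_of_mem (hζ : IsPrimitiveRoot ζ 4) (m : ℕ) (V : HeightOneSpectrum (𝓞 F))
    (hβ : 1 + ζ * 2 ^ (m + 1) ∈ V.asIdeal) :
    V ∈ badPlaces (⟨F, (ζ : F) * 2 ^ m / (1 + (ζ : F) * 2 ^ (m + 1))⟩ : NFPoint) := by
  refine (mem_badPlaces_iff_ord_neg (⟨F, (ζ : F) * 2 ^ m / (1 + (ζ : F) * 2 ^ (m + 1))⟩ : NFPoint) V).2 ?_
  change ord F V (jInv ((ζ : F) * 2 ^ m / (1 + (ζ : F) * 2 ^ (m + 1)))) < 0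
  obtain ⟨h1, h2⟩ := ord_jInv_of_mem hζ m V hβ
  rw [h1]; linarith

/-- **The local height above `1 + i2^{m+1}`**: `h_V(P_m) = 2·ord_V(1 + i2^{m+1})`. [cite: Mochizuki2012, IUTchIV Cor 2.2 (i) p.41] [claim: Mochizuki2012, status: disputed] -/
theorem localHeight_of_mem (hζ : IsPrimitiveRoot ζ 4) (m : ℕ) (V : HeightOneSpectrum (𝓞 F))
    (hβ : 1 + ζ * 2 ^ (m + 1) ∈ V.asIdeal) :
    localHeight (⟨F, (ζ : F) * 2 ^ m / (1 + (ζ : F) * 2 ^ (m + 1))⟩ : NFPoint) V =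
      2 * (ord F V (1 + (ζ : F) * 2 ^ (m + 1)) : ℝ) := by
  rw [localHeight_eq_neg_ord (mem_badPlaces_of_mem hζ m V hβ)]
  change -(ord F V (jInv ((ζ : F) * 2 ^ m / (1 + (ζ : F) * 2 ^ (m + 1)))) : ℝ) = _
  rw [(ord_jInv_of_mem hζ m V hβ).1]
  push_cast
  ring

end SplitBadWitness

end Summit.ABC.IUTFork

end
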